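import Summits.CriticalPhenomena.PercolationContinuityZ3.Theorems.PercNearOneGluingAdditiveGluingTiedRaiseDirection
import HarnessLib

/-!
# Crux `PercNearOneGluing.AdditiveGluing` (stmt-CriticalPhenomena-4576): single-pair MOVES of the zigzag — every probability moves
# affinely at its pivotal rate; the observer's reach of the relays and the "room" event do not move under internal pairs

Support file (`--supports stmt-CriticalPhenomena-4576`, lead prim-png-lead-4576).  No definitions, no named facts, no sorries.

* `tiedRaise_update_eq` — for any pair `e`, event `S` and new weight `s`:  `μ_{w[e↦s]}(S) = μ_w(S) + (s − w e)·g(S)` with the pivotal rate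
  `g(S) = μ_{w[e↦1]}(S) − μ_{w[e↦0]}(S)` (one-bond decomposition `stub_oneBondDecomp_k15`, twice).
* `tiedRaise_update_const` — if gluing `e` does not change `μ(S)` and `w e < 1`, then NO re-weighting of `e` changes `μ(S)`.
* `tiedRaise_reachA_update` — the observer's reach `μ(o ↔ A)` is unchanged when an internal pair `{y,a} ⊆ A` is re-weighted
  (from the landed glued case `tripleTie_reachA_one`).
* `tiedRaise_room_update` — for three relays, the room `μ(o↔b ∖ o↔A)` is unchanged when the pair `{a₁,a₃}` is re-weighted
  (from the landed glued case `fullTie_roomB_one`).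
These are the bookkeeping facts of the moves (Z1)–(Z3) of the lead's zigzag reduction (crux evidence REDUCTION-TRL.md §3').
[cite: KozmaNitzan2024, §5.3 (p. 34), Lemma 4 (p. 9)]
-/

namespace Summit.CriticalPhenomena.PercolationContinuityZ3.Theorems

open MeasureTheory Set Literature.Probability.LatticeModels Literature.Probability.Percolation

noncomputable section
open Classical

variable {n : ℕ}

/-- **Affine move at the pivotal rate**: `μ_{w[e↦s]}(S) = μ_w(S) + (s − w e)·(μ_{w[e↦1]}(S) − μ_{w[e↦0]}(S))`. [folklore] -/
theorem tiedRaise_update_eq (w : Sym2 (Fin n) → unitInterval) (e : Sym2 (Fin n)) (S : Set (BondConfig (Fin n))) (s : unitInterval) :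
    (prodBernoulli (Function.update w e s)).real S =
      (prodBernoulli w).real S + ((s : ℝ) - (w e : ℝ)) *
        ((prodBernoulli (Function.update w e 1)).real S - (prodBernoulli (Function.update w e 0)).real S) := by
  have h1 := stub_oneBondDecomp_k15 n (Function.update w e s) e S
  have h0 := stub_oneBondDecomp_k15 n w e S
  simp only [Function.update_idem, Function.update_self] at h1
  rw [h1, h0]
  ring

/-- If gluing the pair `e` does not change `μ(S)` and `w e < 1`, then `μ_{w[e↦s]}(S) = μ_w(S)` for every `s`. [folklore] -/
theorem tiedRaise_update_const (w : Sym2 (Fin n) → unitInterval) (e : Sym2 (Fin n)) (S : Set (BondConfig (Fin n)))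
    (hglue : (prodBernoulli (Function.update w e 1)).real S = (prodBernoulli w).real S) (hw : (w e : ℝ) < 1) (s : unitInterval) :
    (prodBernoulli (Function.update w e s)).real S = (prodBernoulli w).real S := by
  have h := tiedRaise_gain_eq w e S
  have hpos : (0 : ℝ) < 1 - (w e : ℝ) := by linarith
  have hrate : (prodBernoulli (Function.update w e 1)).real S - (prodBernoulli (Function.update w e 0)).real S = 0 := by
    have hz : (1 - (w e : ℝ)) *
        ((prodBernoulli (Function.update w e 1)).real S - (prodBernoulli (Function.update w e 0)).real S) = 0 := by
      rw [← h, hglue, sub_self]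
    rcases mul_eq_zero.mp hz with h' | h'
    · exact absurd h' (ne_of_gt hpos)
    · exact h'
  rw [tiedRaise_update_eq w e S s, hrate, mul_zero, add_zero]

/-- **The observer's reach of the relay set does not move under an internal pair**: for `y ≠ a` in `A` with `w s(y,a) < 1` and any
new weight `s`, `μ_{w[s(y,a)↦s]}(o ↔ A) = μ_w(o ↔ A)`. [folklore] -/
theorem tiedRaise_reachA_update (w : Sym2 (Fin n) → unitInterval) (A : Finset (Fin n)) {y a : Fin n} (hya : y ≠ a)
    (hy : y ∈ A) (ha : a ∈ A) (o : Fin n) (hw : (w s(y, a) : ℝ) < 1) (s : unitInterval) :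
    (prodBernoulli (Function.update w s(y, a) s)).real (⋃ c ∈ A, openConn o c) =
      (prodBernoulli w).real (⋃ c ∈ A, openConn o c : Set (BondConfig (Fin n))) :=
  tiedRaise_update_const w s(y, a) _ (tripleTie_reachA_one w A hya hy ha o) hw s

/-- **The room does not move under an internal pair** (three relays, pair `{a₁,a₃}`): for `a₁ ≠ a₃` with `w s(a₁,a₃) < 1` and any new
weight `s`, `μ_{w[s(a₁,a₃)↦s]}(o↔b ∩ (o↔a₁ ∪ o↔a₂ ∪ o↔a₃)ᶜ) = μ_w(o↔b ∩ (o↔a₁ ∪ o↔a₂ ∪ o↔a₃)ᶜ)`. [folklore] -/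
theorem tiedRaise_room_update (w : Sym2 (Fin n) → unitInterval) {a₁ a₃ : Fin n} (h : a₁ ≠ a₃) (o a₂ b : Fin n)
    (hw : (w s(a₁, a₃) : ℝ) < 1) (s : unitInterval) :
    (prodBernoulli (Function.update w s(a₁, a₃) s)).real (openConn o b ∩ (openConn o a₁ ∪ openConn o a₂ ∪ openConn o a₃)ᶜ) =
      (prodBernoulli w).real (openConn o b ∩ (openConn o a₁ ∪ openConn o a₂ ∪ openConn o a₃)ᶜ : Set (BondConfig (Fin n))) :=
  tiedRaise_update_const w s(a₁, a₃) _ (fullTie_roomB_one w h o a₂ b) hw s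

/-- **The lossy move (Z1) for three tied relays.**  At a three-way tie raise the pair `e = s(a₁,a₂)` from `w e` to `s ≥ w e` (`w e < 1`),
`w' = w[e ↦ s]`: then `a₁, a₂` stay tied, `a₃` becomes the minimiser, and the observer's connectivity minus the minimum changes by exactly
`(s − w e)·(g_o(e) − g_{a₃}(e))` — the only signed term of a zigzag cycle (its positive part is the "loss", repaid by the moves (Z2), (Z3)
through TRL₃).  [cite: KozmaNitzan2024, §5.3 (p. 34), Lemma 4 (p. 9)] -/
theorem tiedRaise_lossy_move (w : Sym2 (Fin n) → unitInterval) (o b a₁ a₂ a₃ : Fin n) (h12 : a₁ ≠ a₂)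
    (ht12 : (prodBernoulli w).real (openConn a₁ b) = (prodBernoulli w).real (openConn a₂ b))
    (ht13 : (prodBernoulli w).real (openConn a₁ b) = (prodBernoulli w).real (openConn a₃ b))
    (hw : (w s(a₁, a₂) : ℝ) < 1) (s : unitInterval) (hs : (w s(a₁, a₂) : ℝ) ≤ (s : ℝ)) :
    (prodBernoulli (Function.update w s(a₁, a₂) s)).real (openConn a₁ b) =
        (prodBernoulli (Function.update w s(a₁, a₂) s)).real (openConn a₂ b) ∧
      (prodBernoulli (Function.update w s(a₁, a₂) s)).real (openConn a₃ b) ≤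
        (prodBernoulli (Function.update w s(a₁, a₂) s)).real (openConn a₁ b) ∧
      ((prodBernoulli (Function.update w s(a₁, a₂) s)).real (openConn o b) - (prodBernoulli (Function.update w s(a₁, a₂) s)).real (openConn a₃ b))
        - ((prodBernoulli w).real (openConn o b) - (prodBernoulli w).real (openConn a₃ b)) =
        ((s : ℝ) - (w s(a₁, a₂) : ℝ)) *
          (((prodBernoulli (Function.update w s(a₁, a₂) 1)).real (openConn o b) - (prodBernoulli (Function.update w s(a₁, a₂) 0)).real (openConn o b))
            - ((prodBernoulli (Function.update w s(a₁, a₂) 1)).real (openConn a₃ b) - (prodBernoulli (Function.update w s(a₁, a₂) 0)).real (openConn a₃ b))) := by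
  have e1 := tiedRaise_update_eq w s(a₁, a₂) (openConn a₁ b) s
  have e2 := tiedRaise_update_eq w s(a₁, a₂) (openConn a₂ b) s
  have e3 := tiedRaise_update_eq w s(a₁, a₂) (openConn a₃ b) s
  have eo := tiedRaise_update_eq w s(a₁, a₂) (openConn o b) s
  -- common rate of the tied pair and Lemma 4 for the third relay
  have c12 := tiedRaise_rate_eq_of_tie w h12 b ht12 hw
  have d3 := tiedRaise_rate_le w h12 a₃ b ht12.le hw
  have hds : 0 ≤ (s : ℝ) - (w s(a₁, a₂) : ℝ) := sub_nonneg.mpr hs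
  refine ⟨?_, ?_, ?_⟩
  · rw [e1, e2, ht12, c12]
  · rw [e1, e3, ← ht13]
    nlinarith [mul_le_mul_of_nonneg_left d3 hds]
  · rw [e3, eo]
    ring

/-- **Lipschitz drift of a pivotal rate under re-weighting ANOTHER pair**: for pairs `e ≠ e'`, any event `S` and new weight `s` of `e'`,
`|g_S(e)(w[e'↦s]) − g_S(e)(w)| ≤ 2·|s − w e'|` where `g_S(e)(u) = μ_{u[e↦1]}(S) − μ_{u[e↦0]}(S)`.  (The rates entering a zigzag cycle drift
by at most twice the total displacement of the other pairs.) [folklore] -/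
theorem tiedRaise_rate_drift (w : Sym2 (Fin n) → unitInterval) {e e' : Sym2 (Fin n)} (hne : e ≠ e') (S : Set (BondConfig (Fin n)))
    (s : unitInterval) :
    |((prodBernoulli (Function.update (Function.update w e' s) e 1)).real S
        - (prodBernoulli (Function.update (Function.update w e' s) e 0)).real S)
      - ((prodBernoulli (Function.update w e 1)).real S - (prodBernoulli (Function.update w e 0)).real S)|
      ≤ 2 * |(s : ℝ) - (w e' : ℝ)| := by
  -- commute the updates so that `e'` is the outer coordinate
  rw [Function.update_comm (Ne.symm hne) (s : unitInterval) (1 : unitInterval) w,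
    Function.update_comm (Ne.symm hne) (s : unitInterval) (0 : unitInterval) w]
  have h1 := tiedRaise_update_eq (Function.update w e 1) e' S s
  have h0 := tiedRaise_update_eq (Function.update w e 0) e' S s
  have hw1 : (Function.update w e 1) e' = w e' := Function.update_of_ne (Ne.symm hne) _ _
  have hw0 : (Function.update w e 0) e' = w e' := Function.update_of_ne (Ne.symm hne) _ _
  rw [hw1] at h1
  rw [hw0] at h0
  rw [h1, h0]
  -- the two `e'`-rates are differences of probabilities, hence in [-1, 1]
  have b11 : (prodBernoulli (Function.update (Function.update w e 1) e' 1)).real S ≤ 1 := measureReal_le_one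
  have b10 : 0 ≤ (prodBernoulli (Function.update (Function.update w e 1) e' 0)).real S := measureReal_nonneg
  have b11' : 0 ≤ (prodBernoulli (Function.update (Function.update w e 1) e' 1)).real S := measureReal_nonneg
  have b10' : (prodBernoulli (Function.update (Function.update w e 1) e' 0)).real S ≤ 1 := measureReal_le_one
  have b01 : (prodBernoulli (Function.update (Function.update w e 0) e' 1)).real S ≤ 1 := measureReal_le_one
  have b00 : 0 ≤ (prodBernoulli (Function.update (Function.update w e 0) e' 0)).real S := measureReal_nonneg
  have b01' : 0 ≤ (prodBernoulli (Function.update (Function.update w e 0) e' 1)).real S := measureReal_nonneg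
  have b00' : (prodBernoulli (Function.update (Function.update w e 0) e' 0)).real S ≤ 1 := measureReal_le_one
  set d : ℝ := (s : ℝ) - (w e' : ℝ) with hd
  set r1 : ℝ := (prodBernoulli (Function.update (Function.update w e 1) e' 1)).real S
      - (prodBernoulli (Function.update (Function.update w e 1) e' 0)).real S with hr1
  set r0 : ℝ := (prodBernoulli (Function.update (Function.update w e 0) e' 1)).real S
      - (prodBernoulli (Function.update (Function.update w e 0) e' 0)).real S with hr0
  have hr : |r1 - r0| ≤ 2 := by
    rw [abs_le]; constructor <;> linarith
  have key : (prodBernoulli (Function.update w e 1)).real S + d * r1 - ((prodBernoulli (Function.update w e 0)).real S + d * r0)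
      - ((prodBernoulli (Function.update w e 1)).real S - (prodBernoulli (Function.update w e 0)).real S) = d * (r1 - r0) := by ring
  rw [key, abs_mul]
  calc |d| * |r1 - r0| ≤ |d| * 2 := mul_le_mul_of_nonneg_left hr (abs_nonneg d)
    _ = 2 * |d| := by ring

end

end Summit.CriticalPhenomena.PercolationContinuityZ3.Theorems
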